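import Literature.Geometry.Riemannian.LevelSetFlowWeakSetFlow
import HarnessLib

/-!
# The arrival time of the level set flow: attainment and upper semicontinuity

Topic `Literature/Geometry/Riemannian`. Consequences of the closedness of the spacetime track of the
level set flow (`isClosed_track_levelSetFlow`, `LevelSetFlowWeakSetFlow.lean`) and of finite
extinction (`LevelSetFlowExtinction.lean`) for the tree's arrival time
`arrivalTime g K₀ x = sup {t : x ∈ F_t(K₀)} ∈ ℝ≥0∞` (`MeanConvexLevelSetFlow.lean`; Colding–Minicozzi
2016, §1) of a COMPACT `K₀ ⊆ ℝⁿ⁺¹`, `n ≥ 1`: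

* `isClosed_setOf_mem_levelSetFlow`, `bddAbove_setOf_mem_levelSetFlow` — the set of times at
  which `x` lies in the flow is closed and bounded above;
* `exists_isGreatest_arrivalTime` — **the arrival time is attained** (a greatest such time `t*`,
  `u(x) = t*`); `mem_levelSetFlow_arrivalTime` — `x ∈ F_{u(x)}(K₀)` for `x ∈ K₀`;
  `arrivalTime_le_of_forall_eq_empty`, `arrivalTime_eq_zero_of_forall_notMem`;
* `levelSetFlow_subset_ball_uniform` — all slices up to time `T` lie in one ball;
* `isClosed_setOf_le_arrivalTime` — superlevel sets `{u ≥ r}`, `r > 0`, are projections of compact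
  pieces of the track, hence closed; `upperSemicontinuous_arrivalTime` — **`u` is upper
  semicontinuous**; `exists_arrivalTime_eq_extinctionTime` — the extinction time of a nonempty
  compact set is the arrival time of one of its points;
* `infDist_levelSetFlow_le` — one-sided Hölder continuity in time: `F_t(K₀)` lies within
  `√(2n(t - s))` of `F_s(K₀)`; `le_arrivalTime_of_closedBall_subset`,
  `arrivalTime_pos_of_mem_interior`, `arrivalTime_mem_Icc` — `ρ²/(2n) ≤ u(x) ≤ R²/(2n)` for
  `B̄(x, ρ) ⊆ K₀ ⊆ B(c, R)` (appended).

(For mean-convex `K₀` the arrival time is much better — Lipschitz, `C²` at the end — by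
Colding–Minicozzi 2016; here only what holds for every compact initial set.) Everything is
PROVED; no definitions, no named facts.

## References

* T. H. Colding, W. P. Minicozzi II, *Differentiability of the arrival time*, Comm. Pure Appl.
  Math. 69 (2016), §1. [ColdingMinicozzi2016]
* B. White, *The size of the singular set in mean curvature flow of mean-convex sets*, J. Amer.
  Math. Soc. 13 (2000), §2. [White2000]
* L. C. Evans, J. Spruck, *Motion of level sets by mean curvature. I*, J. Differential Geom. 33
  (1991), Thm. 7.1 (a). [EvansSpruck1991]
-/

noncomputable section

open Bundle Set Function Metric Module Filter
open scoped Manifold ContDiff Topology ENNReal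

namespace Literature.Geometry.Riemannian

open Lorentzian Lorentzian.PseudoRiemannianMetric

variable {n : ℕ}

/-! ### The set of times at which a point lies in the level set flow -/

section TimeSet

/-- Membership in the level set flow forces `t ≥ 0`. [folklore] -/
theorem nonneg_of_mem_levelSetFlow {K₀ : Set (EuclideanSpace ℝ (Fin (n + 1)))} {t : ℝ}
    {x : EuclideanSpace ℝ (Fin (n + 1))}
    (hx : x ∈ levelSetFlow (euclideanMetric (EuclideanSpace ℝ (Fin (n + 1)))) K₀ t) : 0 ≤ t :=
  hx.1

/-- **The times at which `x` lies in the flow form a closed set** (closed track,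
`isClosed_track_levelSetFlow`). [cite: White2000, §2] -/
theorem isClosed_setOf_mem_levelSetFlow (hn : 1 ≤ n) {K₀ : Set (EuclideanSpace ℝ (Fin (n + 1)))}
    (hK₀ : IsClosed K₀) (x : EuclideanSpace ℝ (Fin (n + 1))) :
    IsClosed {t : ℝ | x ∈ levelSetFlow (euclideanMetric (EuclideanSpace ℝ (Fin (n + 1)))) K₀ t} := by
  have h := (isClosed_track_levelSetFlow hn hK₀).preimage (Continuous.prodMk_right x)
  convert h using 1
  ext t
  simp only [mem_setOf_eq, mem_preimage]
  exact ⟨fun hx ↦ ⟨hx.1, hx⟩, fun hx ↦ hx.2⟩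

/-- For bounded `K₀` these times are bounded above (finite extinction). [cite: EvansSpruck1991, Thm. 7.1 (a)] -/
theorem bddAbove_setOf_mem_levelSetFlow (hn : 1 ≤ n) {K₀ : Set (EuclideanSpace ℝ (Fin (n + 1)))}
    (hK₀ : Bornology.IsBounded K₀) (x : EuclideanSpace ℝ (Fin (n + 1))) :
    BddAbove {t : ℝ | x ∈ levelSetFlow (euclideanMetric (EuclideanSpace ℝ (Fin (n + 1)))) K₀ t} := by
  obtain ⟨T, hT⟩ := exists_levelSetFlow_eq_empty_of_isBounded hn hK₀
  refine ⟨T, fun t ht ↦ ?_⟩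
  have ht' : x ∈ levelSetFlow (euclideanMetric (EuclideanSpace ℝ (Fin (n + 1)))) K₀ t := ht
  by_contra hlt
  rw [not_le] at hlt
  rw [hT t hlt] at ht'
  exact ht'

/-- **The arrival time is attained**: for compact `K₀`, if `x` lies in the flow at some time then
the set of such times has a greatest element `t*`, and `arrivalTime K₀ x = t*` (in `ℝ≥0∞`).
[cite: ColdingMinicozzi2016, §1] [cite: White2000, §2] -/
theorem exists_isGreatest_arrivalTime (hn : 1 ≤ n) {K₀ : Set (EuclideanSpace ℝ (Fin (n + 1)))}
    (hK₀ : IsCompact K₀) {x : EuclideanSpace ℝ (Fin (n + 1))} {t₀ : ℝ}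
    (hx : x ∈ levelSetFlow (euclideanMetric (EuclideanSpace ℝ (Fin (n + 1)))) K₀ t₀) :
    ∃ t : ℝ, IsGreatest
        {t : ℝ | x ∈ levelSetFlow (euclideanMetric (EuclideanSpace ℝ (Fin (n + 1)))) K₀ t} t ∧
      arrivalTime (euclideanMetric (EuclideanSpace ℝ (Fin (n + 1)))) K₀ x = ENNReal.ofReal t := by
  set S := {t : ℝ | x ∈ levelSetFlow (euclideanMetric (EuclideanSpace ℝ (Fin (n + 1)))) K₀ t}
    with hS
  have hne : S.Nonempty := ⟨t₀, hx⟩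
  have hbdd := bddAbove_setOf_mem_levelSetFlow hn hK₀.isBounded x
  have hmem : sSup S ∈ S := (isClosed_setOf_mem_levelSetFlow hn hK₀.isClosed x).csSup_mem hne hbdd
  refine ⟨sSup S, ⟨hmem, fun t ht ↦ le_csSup hbdd ht⟩, le_antisymm ?_ (le_arrivalTime hmem)⟩
  exact arrivalTime_le fun t ht ↦ ENNReal.ofReal_le_ofReal (le_csSup hbdd ht)

/-- **Points of `K₀` lie in the flow at their arrival time**: `x ∈ F_{u(x)}(K₀)` for `x ∈ K₀`
(compact), reading `u(x) ∈ ℝ≥0∞` back in `ℝ`. [cite: ColdingMinicozzi2016, §1] -/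
theorem mem_levelSetFlow_arrivalTime (hn : 1 ≤ n) {K₀ : Set (EuclideanSpace ℝ (Fin (n + 1)))}
    (hK₀ : IsCompact K₀) {x : EuclideanSpace ℝ (Fin (n + 1))} (hx : x ∈ K₀) :
    x ∈ levelSetFlow (euclideanMetric (EuclideanSpace ℝ (Fin (n + 1)))) K₀
      (arrivalTime (euclideanMetric (EuclideanSpace ℝ (Fin (n + 1)))) K₀ x).toReal := by
  have h0 : x ∈ levelSetFlow (euclideanMetric (EuclideanSpace ℝ (Fin (n + 1)))) K₀ 0 := by
    rw [levelSetFlow_zero hK₀.isClosed]; exact hx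
  obtain ⟨t, ht, hu⟩ := exists_isGreatest_arrivalTime hn hK₀ h0
  rw [hu, ENNReal.toReal_ofReal (nonneg_of_mem_levelSetFlow ht.1)]
  exact ht.1

/-- Every arrival time is bounded by a finite extinction bound: `u(x) ≤ T` for all `x` (not only
`x ∈ K₀`) whenever `F_t(K₀) = ∅` for `t > T`. [cite: EvansSpruck1991, Thm. 7.1 (a)] -/
theorem arrivalTime_le_of_forall_eq_empty {K₀ : Set (EuclideanSpace ℝ (Fin (n + 1)))} {T : ℝ}
    (hT : ∀ t, T < t → levelSetFlow (euclideanMetric (EuclideanSpace ℝ (Fin (n + 1)))) K₀ t = ∅)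
    (x : EuclideanSpace ℝ (Fin (n + 1))) :
    arrivalTime (euclideanMetric (EuclideanSpace ℝ (Fin (n + 1)))) K₀ x ≤ ENNReal.ofReal T := by
  refine arrivalTime_le fun t ht ↦ ENNReal.ofReal_le_ofReal ?_
  by_contra hlt
  rw [not_le] at hlt
  rw [hT t hlt] at ht
  exact ht

end TimeSet

/-! ### Upper semicontinuity of the arrival time -/

section USC

/-- A point never in the flow has arrival time `0`. [folklore] -/
theorem arrivalTime_eq_zero_of_forall_notMem {K₀ : Set (EuclideanSpace ℝ (Fin (n + 1)))}
    {x : EuclideanSpace ℝ (Fin (n + 1))}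
    (hx : ∀ t, x ∉ levelSetFlow (euclideanMetric (EuclideanSpace ℝ (Fin (n + 1)))) K₀ t) :
    arrivalTime (euclideanMetric (EuclideanSpace ℝ (Fin (n + 1)))) K₀ x = 0 :=
  le_antisymm (by simpa using arrivalTime_le (T := 0) fun t ht ↦ absurd ht (hx t)) bot_le

/-- **All slices of the level set flow of a bounded set lie in one ball**: if `K₀ ⊆ B(0, R)` then
`F_t(K₀) ⊆ B(0, max R (√(2nT) + 1))` for `0 ≤ t ≤ T` (outer sphere barriers). [cite: EvansSpruck1991, Thm. 7.1 (a)] -/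
theorem levelSetFlow_subset_ball_uniform (hn : 1 ≤ n) {K₀ : Set (EuclideanSpace ℝ (Fin (n + 1)))}
    {R : ℝ} (hR : K₀ ⊆ ball 0 R) {T t : ℝ} (hT : 0 ≤ T) (htT : t ≤ T) :
    levelSetFlow (euclideanMetric (EuclideanSpace ℝ (Fin (n + 1)))) K₀ t ⊆
      ball 0 (max R (Real.sqrt (2 * n * T) + 1)) := by
  intro x hx
  have ht0 : 0 ≤ t := hx.1
  have hn0 : (0 : ℝ) < n := by exact_mod_cast hn
  set ρ := max R (Real.sqrt (2 * n * T) + 1) with hρ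
  have hsub : K₀ ⊆ ball 0 ρ := hR.trans (ball_subset_ball (le_max_left _ _))
  have hlt : 2 * n * t < ρ ^ 2 := by
    have h1 : Real.sqrt (2 * n * T) + 1 ≤ ρ := le_max_right _ _
    have h2 : 0 ≤ Real.sqrt (2 * n * T) := Real.sqrt_nonneg _
    have h3 := Real.sq_sqrt (show 0 ≤ 2 * n * T by positivity)
    nlinarith
  have h := levelSetFlow_subset_ball hn hsub hlt hx
  rw [mem_ball] at h ⊢
  refine h.trans_le ?_
  rw [Real.sqrt_le_left ((le_max_right _ _).trans' (by positivity))]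
  nlinarith

/-- **Superlevel sets of the arrival time are closed**: for compact `K₀` and `r > 0`,
`{x : u(x) ≥ r}` is the projection of the compact piece `track ∩ (ℝⁿ⁺¹ × [r, T])` of the closed
track (`T` an extinction bound), hence closed. [cite: ColdingMinicozzi2016, §1] [cite: White2000, §2] -/
theorem isClosed_setOf_le_arrivalTime (hn : 1 ≤ n) {K₀ : Set (EuclideanSpace ℝ (Fin (n + 1)))}
    (hK₀ : IsCompact K₀) {r : ℝ} (hr : 0 < r) :
    IsClosed {x : EuclideanSpace ℝ (Fin (n + 1)) |
      ENNReal.ofReal r ≤ arrivalTime (euclideanMetric (EuclideanSpace ℝ (Fin (n + 1)))) K₀ x} := by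
  set g := euclideanMetric (EuclideanSpace ℝ (Fin (n + 1))) with hg
  obtain ⟨R, hR⟩ := hK₀.isBounded.subset_ball 0
  obtain ⟨T, hT⟩ := exists_levelSetFlow_eq_empty_of_isBounded hn hK₀.isBounded
  set Tr : Set (EuclideanSpace ℝ (Fin (n + 1)) × ℝ) := {p | 0 ≤ p.2 ∧ p.1 ∈ levelSetFlow g K₀ p.2}
    with hTr
  -- the compact piece of the track over `[r, T]`
  have hle : ∀ {t x}, x ∈ levelSetFlow g K₀ t → t ≤ T := fun {t x} hx ↦ by
    by_contra hlt
    rw [not_le] at hlt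
    rw [hT t hlt] at hx
    exact hx
  have hcpt : IsCompact (Tr ∩ univ ×ˢ Icc r T) := by
    rcases lt_or_ge T 0 with hT0 | hT0
    · -- everything is extinct at once
      convert isCompact_empty
      ext ⟨x, t⟩
      simp only [mem_inter_iff, mem_prod, mem_univ, true_and, mem_Icc, mem_empty_iff_false,
        iff_false, not_and, not_le]
      intro hp _
      linarith [hle hp.2]
    have hbig : IsCompact (closedBall (0 : EuclideanSpace ℝ (Fin (n + 1)))
        (max R (Real.sqrt (2 * n * T) + 1)) ×ˢ Icc r T) :=
      (isCompact_closedBall _ _).prod isCompact_Icc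
    refine hbig.of_isClosed_subset
      ((isClosed_track_levelSetFlow hn hK₀.isClosed).inter (isClosed_univ.prod isClosed_Icc)) ?_
    rintro ⟨x, t⟩ ⟨⟨_, hx⟩, -, ht⟩
    exact ⟨ball_subset_closedBall (levelSetFlow_subset_ball_uniform hn hR hT0 ht.2 hx), ht⟩
  have heq : {x : EuclideanSpace ℝ (Fin (n + 1)) | ENNReal.ofReal r ≤ arrivalTime g K₀ x} =
      Prod.fst '' (Tr ∩ univ ×ˢ Icc r T) := by
    ext x
    simp only [mem_setOf_eq, mem_image, mem_inter_iff, mem_prod, mem_univ, true_and, mem_Icc,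
      Prod.exists, exists_and_right, exists_eq_right]
    constructor
    · intro hux
      -- `x` lies in the flow at some time, hence at a greatest time `t* ≥ r`
      have hex : ∃ t₀, x ∈ levelSetFlow g K₀ t₀ := by
        by_contra hno
        push Not at hno
        rw [arrivalTime_eq_zero_of_forall_notMem hno] at hux
        exact absurd hux (not_le.2 (ENNReal.ofReal_pos.2 hr))
      obtain ⟨t₀, ht₀⟩ := hex
      obtain ⟨t, ht, hu⟩ := exists_isGreatest_arrivalTime hn hK₀ ht₀
      rw [hu, ENNReal.ofReal_le_ofReal_iff (nonneg_of_mem_levelSetFlow ht.1)] at hux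
      exact ⟨t, ⟨nonneg_of_mem_levelSetFlow ht.1, ht.1⟩, hux, hle ht.1⟩
    · rintro ⟨t, ⟨-, hxt⟩, hrt, -⟩
      exact (ENNReal.ofReal_le_ofReal hrt).trans (le_arrivalTime hxt)
  rw [heq]
  exact (hcpt.image continuous_fst).isClosed

/-- **The arrival time of a compact set is upper semicontinuous** on `ℝⁿ⁺¹` (as an
`ℝ≥0∞`-valued function; Colding–Minicozzi 2016, §1: the arrival time of a mean-convex set is even
Lipschitz / twice differentiable — here only the semicontinuity valid for ALL compact initial sets,
from the closedness of the track). [cite: ColdingMinicozzi2016, §1] [cite: White2000, §2] -/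
theorem upperSemicontinuous_arrivalTime (hn : 1 ≤ n) {K₀ : Set (EuclideanSpace ℝ (Fin (n + 1)))}
    (hK₀ : IsCompact K₀) :
    UpperSemicontinuous fun x ↦ arrivalTime (euclideanMetric (EuclideanSpace ℝ (Fin (n + 1)))) K₀ x := by
  rw [upperSemicontinuous_iff_isClosed_preimage]
  intro y
  obtain ⟨T, hT⟩ := exists_levelSetFlow_eq_empty_of_isBounded hn hK₀.isBounded
  rcases eq_or_ne y 0 with rfl | hy0
  · convert isClosed_univ; ext x; simp
  rcases eq_or_ne y ⊤ with rfl | hytop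
  · convert isClosed_empty
    ext x
    simp only [mem_preimage, mem_Ici, top_le_iff, mem_empty_iff_false, iff_false]
    exact ne_top_of_le_ne_top ENNReal.ofReal_ne_top (arrivalTime_le_of_forall_eq_empty hT x)
  · have hr : 0 < y.toReal := ENNReal.toReal_pos hy0 hytop
    have h := isClosed_setOf_le_arrivalTime hn hK₀ hr
    rwa [ENNReal.ofReal_toReal hytop] at h

/-- **The extinction time of a nonempty compact set is an arrival time**: `T(K₀) = u(x₀)` for some
`x₀ ∈ K₀` (an upper semicontinuous function attains its maximum on a compact set).
[cite: ColdingMinicozzi2016, §1] -/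
theorem exists_arrivalTime_eq_extinctionTime (hn : 1 ≤ n)
    {K₀ : Set (EuclideanSpace ℝ (Fin (n + 1)))} (hK₀ : IsCompact K₀) (hne : K₀.Nonempty) :
    ∃ x₀ ∈ K₀, arrivalTime (euclideanMetric (EuclideanSpace ℝ (Fin (n + 1)))) K₀ x₀ =
      extinctionTime (euclideanMetric (EuclideanSpace ℝ (Fin (n + 1)))) K₀ := by
  obtain ⟨x₀, hx₀, hmax⟩ := (upperSemicontinuous_arrivalTime hn hK₀).upperSemicontinuousOn
    K₀ |>.exists_isMaxOn hne hK₀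
  refine ⟨x₀, hx₀, le_antisymm (arrivalTime_le_extinctionTime hx₀) ?_⟩
  exact iSup₂_le fun x hx ↦ hmax hx

end USC

/-! ### Bounds for the arrival time; one-sided continuity of the flow in time -/

section Bounds

/-- **One-sided Hölder continuity of the level set flow in time**: every point of `F_t(K₀)` lies
within distance `√(2n(t - s))` of `F_s(K₀)`, `0 ≤ s ≤ t` (backward reach,
`exists_mem_levelSetFlow_dist_le`). [cite: White2000, §2] -/
theorem infDist_levelSetFlow_le (hn : 1 ≤ n) {K₀ : Set (EuclideanSpace ℝ (Fin (n + 1)))} {s t : ℝ}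
    (hs : 0 ≤ s) (hst : s ≤ t) {x : EuclideanSpace ℝ (Fin (n + 1))}
    (hx : x ∈ levelSetFlow (euclideanMetric (EuclideanSpace ℝ (Fin (n + 1)))) K₀ t) :
    infDist x (levelSetFlow (euclideanMetric (EuclideanSpace ℝ (Fin (n + 1)))) K₀ s) ≤
      Real.sqrt (2 * n * (t - s)) := by
  have hn0 : (0 : ℝ) < n := by exact_mod_cast hn
  have h0 : 0 ≤ 2 * n * (t - s) := by nlinarith [sub_nonneg.2 hst]
  refine le_of_forall_gt_imp_ge_of_dense fun ρ hρ ↦ ?_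
  have hρpos : 0 < ρ := (Real.sqrt_nonneg _).trans_lt hρ
  obtain ⟨y, hy, hyx⟩ := exists_mem_levelSetFlow_dist_le hn hs hst hx hρpos
    ((Real.sqrt_lt' hρpos).1 hρ)
  calc infDist x _ ≤ dist x y := infDist_le_dist_of_mem hy
    _ = dist y x := dist_comm _ _
    _ ≤ ρ := hyx

/-- **Lower bound for the arrival time at interior points**: if `B̄(x, ρ) ⊆ K₀` then
`u(x) ≥ ρ²/(2n)` — the level set flow of the ball `B̄(x, ρ)` (`levelSetFlow_closedBall`,
`LevelSetFlowBalls.lean`) reaches its centre at time `ρ²/(2n)` and lies below that of `K₀`.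
[cite: EvansSpruck1991, §7.1 (7.2)–(7.3)] [cite: ColdingMinicozzi2016, §1] -/
theorem le_arrivalTime_of_closedBall_subset (hn : 1 ≤ n) {K₀ : Set (EuclideanSpace ℝ (Fin (n + 1)))}
    {x : EuclideanSpace ℝ (Fin (n + 1))} {ρ : ℝ} (hρ : 0 ≤ ρ) (hK₀ : closedBall x ρ ⊆ K₀) :
    ENNReal.ofReal (ρ ^ 2 / (2 * n)) ≤
      arrivalTime (euclideanMetric (EuclideanSpace ℝ (Fin (n + 1)))) K₀ x := by
  have hn0 : (0 : ℝ) < n := by exact_mod_cast hn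
  refine le_arrivalTime (levelSetFlow_mono hK₀ _ ?_)
  have ht : 2 * n * (ρ ^ 2 / (2 * n)) ≤ ρ ^ 2 := by
    rw [mul_div_cancel₀ _ (by positivity)]
  rw [levelSetFlow_closedBall hn x hρ (by positivity) ht, mem_closedBall, dist_self]
  exact Real.sqrt_nonneg _

/-- In particular **interior points of `K₀` have positive arrival time**.
[cite: ColdingMinicozzi2016, §1] -/
theorem arrivalTime_pos_of_mem_interior (hn : 1 ≤ n) {K₀ : Set (EuclideanSpace ℝ (Fin (n + 1)))}
    {x : EuclideanSpace ℝ (Fin (n + 1))} (hx : x ∈ interior K₀) :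
    0 < arrivalTime (euclideanMetric (EuclideanSpace ℝ (Fin (n + 1)))) K₀ x := by
  have hn0 : (0 : ℝ) < n := by exact_mod_cast hn
  obtain ⟨ρ, hρ, hball⟩ := Metric.mem_nhds_iff.1 (mem_interior_iff_mem_nhds.1 hx)
  have hsub : closedBall x (ρ / 2) ⊆ K₀ := (closedBall_subset_ball (by linarith)).trans hball
  refine lt_of_lt_of_le ?_ (le_arrivalTime_of_closedBall_subset hn (by linarith) hsub)
  exact ENNReal.ofReal_pos.2 (by positivity)

/-- **Two-sided bounds for the arrival time of a compact set at an interior point**: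
`ρ²/(2n) ≤ u(x) ≤ R²/(2n)` if `B̄(x, ρ) ⊆ K₀ ⊆ B(c, R)` (inner: the ball's own flow; outer:
`arrivalTime_le_of_subset_ball`, `LevelSetFlowExtinction.lean`). [cite: EvansSpruck1991, §7.1 and Thm. 7.1 (a)] -/
theorem arrivalTime_mem_Icc (hn : 1 ≤ n) {K₀ : Set (EuclideanSpace ℝ (Fin (n + 1)))}
    {x c : EuclideanSpace ℝ (Fin (n + 1))} {ρ R : ℝ} (hρ : 0 ≤ ρ) (hin : closedBall x ρ ⊆ K₀)
    (hout : K₀ ⊆ ball c R) :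
    arrivalTime (euclideanMetric (EuclideanSpace ℝ (Fin (n + 1)))) K₀ x ∈
      Set.Icc (ENNReal.ofReal (ρ ^ 2 / (2 * n))) (ENNReal.ofReal (R ^ 2 / (2 * n))) :=
  ⟨le_arrivalTime_of_closedBall_subset hn hρ hin, arrivalTime_le_of_subset_ball hn hout x⟩

end Bounds

end Literature.Geometry.Riemannian

end
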